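import Summits.ResolutionOfSingularities.ResolutionOfSingularities.Theorems.FrobeniusLadderFInjectiveMacaulayficationCIPolyKit
import Mathlib.LinearAlgebra.Matrix.Determinant.Basic
import HarnessLib

/-!
# CI POLY KIT, part 2 — the smooth-face certificate of a two-equation chart from `decide`-able list data
# (crux `FInjectiveMacaulayfication`, CI-CN engine, K-T4 Lean half; seat res-L1-w45a-stub-6 = res-D-pv-018)

Support file for crux stmt-ResolutionOfSingularities-15315. [OURS · L1 W4.5a] — NOT a statement of the manuscript; AI-written, weaker
than expert review.

`hcert_two_of_lists`: for chart equations `g₀, g₁` given as term lists `G 0, G 1`, a stratum `S`, an exponent `e`, column choices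
`cols μ : Fin 2 → Fin n` and cofactor lists `A l`, `B μ`, the hypothesis `hcert` of `CISmoothChart.ci_clause_of_smoothFaceCertificate` /
`CIOrbitExpectedDim.*_of_smoothFaceCertificate` — `Y^e ∈ (g₀^S, g₁^S) + (det(∂_{cols μ i} g_l^S))_μ` — follows from ONE `decide`-able
congruence of integer coefficient sums: the list `RHS = Σ_l A_l ⋆ G_l^S + Σ_μ B_μ ⋆ DET_μ` (all operations on lists) has the same
coefficients as `Y^e` modulo `p`. No definition is declared. [folklore]
-/

-- single-problem summit: the doubled namespace component is forced
set_option linter.dupNamespace false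

noncomputable section

namespace Summit.ResolutionOfSingularities.ResolutionOfSingularities.Theorems.FInjectiveMacaulayfication.CIPolyKitCert

open MvPolynomial
open Summit.ResolutionOfSingularities.ResolutionOfSingularities.Theorems.FInjectiveMacaulayfication

variable {K : Type} [CommRing K] {n : ℕ}

/-- The value of a `flatMap` lies in an ideal when the value of every piece does. [folklore] -/
theorem evalL_flatMap_mem {ι : Type} (l : List ι) (f : ι → List (ℤ × (Fin n → ℕ))) (I : Ideal (MvPolynomial (Fin n) K))
    (h : ∀ i ∈ l, ((f i).map fun t : ℤ × (Fin n → ℕ) =>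
        (monomial (Finsupp.equivFunOnFinite.symm t.2) ((t.1 : ℤ) : K) : MvPolynomial (Fin n) K)).sum ∈ I) :
    ((l.flatMap f).map fun t : ℤ × (Fin n → ℕ) =>
        (monomial (Finsupp.equivFunOnFinite.symm t.2) ((t.1 : ℤ) : K) : MvPolynomial (Fin n) K)).sum ∈ I := by
  induction l with
  | nil => simp
  | cons i l ih =>
    rw [List.flatMap_cons, CIPolyKit.evalL_append]
    exact I.add_mem (h i (by simp)) (ih fun i' hi' => h i' (by simp [hi']))

/-- **THE SMOOTH-FACE CERTIFICATE OF A TWO-EQUATION CHART FROM LIST DATA.** See the module docstring; `hcheck` is decided by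
`decide` on literal data. The conclusion is VERBATIM the hypothesis `hcert` of `CISmoothChart.ci_clause_of_smoothFaceCertificate` for
`g l = value (G l)`. [folklore] -/
theorem hcert_two_of_lists (p : ℕ) [CharP K p] (G : Fin 2 → List (ℤ × (Fin n → ℕ))) (S : Finset (Fin n))
    (e : Fin n → ℕ) (t : ℕ) (cols : Fin t → Fin 2 → Fin n)
    (A : Fin 2 → List (ℤ × (Fin n → ℕ))) (B : Fin t → List (ℤ × (Fin n → ℕ)))
    (hcheck :
      let GS : Fin 2 → List (ℤ × (Fin n → ℕ)) := fun l => (G l).filter fun t => ∀ i ∈ S, t.2 i = 0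
      let pd : Fin n → List (ℤ × (Fin n → ℕ)) → List (ℤ × (Fin n → ℕ)) := fun j L =>
        L.map fun t => (t.1 * (t.2 j : ℤ), Function.update t.2 j (t.2 j - 1))
      let mul : List (ℤ × (Fin n → ℕ)) → List (ℤ × (Fin n → ℕ)) → List (ℤ × (Fin n → ℕ)) := fun L₁ L₂ =>
        L₁.flatMap fun s => L₂.map fun t => (s.1 * t.1, s.2 + t.2)
      let neg : List (ℤ × (Fin n → ℕ)) → List (ℤ × (Fin n → ℕ)) := fun L => L.map fun t => (-t.1, t.2)
      let DET : Fin t → List (ℤ × (Fin n → ℕ)) := fun μ =>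
        mul (pd (cols μ 0) (GS 0)) (pd (cols μ 1) (GS 1)) ++ neg (mul (pd (cols μ 0) (GS 1)) (pd (cols μ 1) (GS 0)))
      let RHS : List (ℤ × (Fin n → ℕ)) :=
        (List.finRange 2).flatMap (fun l => mul (A l) (GS l)) ++ (List.finRange t).flatMap (fun μ => mul (B μ) (DET μ))
      ∀ v ∈ e :: RHS.map (fun t => t.2),
        (p : ℤ) ∣ (([((1 : ℤ), e)].filter fun t : ℤ × (Fin n → ℕ) => t.2 = v).map (fun t => t.1)).sum -
          ((RHS.filter fun t : ℤ × (Fin n → ℕ) => t.2 = v).map (fun t => t.1)).sum) :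
    (monomial (Finsupp.equivFunOnFinite.symm e) (1 : K) : MvPolynomial (Fin n) K) ∈
      Ideal.span (Set.range fun l : Fin 2 =>
          aeval (fun i : Fin n => if i ∈ S then (0 : MvPolynomial (Fin n) K) else X i)
            ((G l).map fun t : ℤ × (Fin n → ℕ) =>
              (monomial (Finsupp.equivFunOnFinite.symm t.2) ((t.1 : ℤ) : K) : MvPolynomial (Fin n) K)).sum) ⊔
        Ideal.span (Set.range fun μ : Fin t => (Matrix.of fun i l => pderiv (cols μ i)
          (aeval (fun i : Fin n => if i ∈ S then (0 : MvPolynomial (Fin n) K) else X i)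
            ((G l).map fun t : ℤ × (Fin n → ℕ) =>
              (monomial (Finsupp.equivFunOnFinite.symm t.2) ((t.1 : ℤ) : K) : MvPolynomial (Fin n) K)).sum)).det) := by
  classical
  -- abbreviations (the same lists as in `hcheck`)
  set GS : Fin 2 → List (ℤ × (Fin n → ℕ)) := fun l => (G l).filter fun t => ∀ i ∈ S, t.2 i = 0 with hGS
  set pd : Fin n → List (ℤ × (Fin n → ℕ)) → List (ℤ × (Fin n → ℕ)) := fun j L =>
    L.map fun t => (t.1 * (t.2 j : ℤ), Function.update t.2 j (t.2 j - 1)) with hpd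
  set mul : List (ℤ × (Fin n → ℕ)) → List (ℤ × (Fin n → ℕ)) → List (ℤ × (Fin n → ℕ)) := fun L₁ L₂ =>
    L₁.flatMap fun s => L₂.map fun t => (s.1 * t.1, s.2 + t.2) with hmul
  set neg : List (ℤ × (Fin n → ℕ)) → List (ℤ × (Fin n → ℕ)) := fun L => L.map fun t => (-t.1, t.2) with hneg
  set DET : Fin t → List (ℤ × (Fin n → ℕ)) := fun μ =>
    mul (pd (cols μ 0) (GS 0)) (pd (cols μ 1) (GS 1)) ++ neg (mul (pd (cols μ 0) (GS 1)) (pd (cols μ 1) (GS 0))) with hDET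
  set RHS : List (ℤ × (Fin n → ℕ)) :=
    (List.finRange 2).flatMap (fun l => mul (A l) (GS l)) ++ (List.finRange t).flatMap (fun μ => mul (B μ) (DET μ)) with hRHS
  -- the value map
  let ev : List (ℤ × (Fin n → ℕ)) → MvPolynomial (Fin n) K := fun L =>
    (L.map fun t : ℤ × (Fin n → ℕ) =>
      (monomial (Finsupp.equivFunOnFinite.symm t.2) ((t.1 : ℤ) : K) : MvPolynomial (Fin n) K)).sum
  have hev : ∀ L, ev L = (L.map fun t : ℤ × (Fin n → ℕ) =>
      (monomial (Finsupp.equivFunOnFinite.symm t.2) ((t.1 : ℤ) : K) : MvPolynomial (Fin n) K)).sum := fun L => rfl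
  -- the restricted equations
  set σS := fun i : Fin n => if i ∈ S then (0 : MvPolynomial (Fin n) K) else X i with hσS
  have hgS : ∀ l : Fin 2, aeval σS (ev (G l)) = ev (GS l) := by
    intro l
    rw [hev, hev, hσS, CIPolyKit.substZero_evalL]
  -- the minors
  have hdet : ∀ μ : Fin t, (Matrix.of fun i l => pderiv (cols μ i) (aeval σS (ev (G l)))).det = ev (DET μ) := by
    intro μ
    rw [Matrix.det_fin_two]
    simp only [Matrix.of_apply, hgS]
    rw [hev (GS 0), hev (GS 1), CIPolyKit.pderiv_evalL, CIPolyKit.pderiv_evalL, CIPolyKit.pderiv_evalL,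
      CIPolyKit.pderiv_evalL, hev, hDET]
    simp only []
    rw [CIPolyKit.evalL_append, CIPolyKit.evalL_neg, hmul]
    simp only []
    rw [CIPolyKit.evalL_mul, CIPolyKit.evalL_mul, hpd]
    ring
  -- `Y^e = value RHS`
  have hmono : (monomial (Finsupp.equivFunOnFinite.symm e) (1 : K) : MvPolynomial (Fin n) K) = ev [((1 : ℤ), e)] := by
    rw [hev]; simp
  have hval : ev [((1 : ℤ), e)] = ev RHS := by
    rw [hev, hev]
    refine CIPolyKit.evalL_eq_of_coeff_congr p _ _ fun v hv => ?_
    have hv' : v ∈ e :: RHS.map (fun t => t.2) := by simpa using hv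
    exact hcheck v hv'
  rw [hmono, hval, hev, hRHS, CIPolyKit.evalL_append]
  refine Submodule.add_mem_sup ?_ ?_
  · refine evalL_flatMap_mem _ _ _ fun l _ => ?_
    rw [hmul]
    simp only []
    rw [CIPolyKit.evalL_mul]
    have h := hgS l
    rw [hev, hev] at h
    rw [← h]
    exact Ideal.mul_mem_left _ _ (Ideal.subset_span ⟨l, rfl⟩)
  · refine evalL_flatMap_mem _ _ _ fun μ _ => ?_
    rw [hmul]
    simp only []
    rw [CIPolyKit.evalL_mul]
    have h := hdet μ
    rw [hev (DET μ)] at h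
    rw [← h]
    exact Ideal.mul_mem_left _ _ (Ideal.subset_span ⟨μ, rfl⟩)

/-- **One stratum entry of `CISmoothChart.ci_clause_of_smoothFaceCertificates`' hypothesis from list data** (the `∃ t js e, …`
form, `e` as a `Finsupp`): the shape a generated chart module emits per stratum, both side conditions by `decide`. [folklore] -/
theorem hcerts_entry_two (p : ℕ) [CharP K p] (G : Fin 2 → List (ℤ × (Fin n → ℕ))) (S : Finset (Fin n))
    (e : Fin n → ℕ) (t : ℕ) (cols : Fin t → Fin 2 → Fin n)
    (A : Fin 2 → List (ℤ × (Fin n → ℕ))) (B : Fin t → List (ℤ × (Fin n → ℕ)))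
    (he : ∀ i ∈ S, e i = 0)
    (hcheck :
      let GS : Fin 2 → List (ℤ × (Fin n → ℕ)) := fun l => (G l).filter fun t => ∀ i ∈ S, t.2 i = 0
      let pd : Fin n → List (ℤ × (Fin n → ℕ)) → List (ℤ × (Fin n → ℕ)) := fun j L =>
        L.map fun t => (t.1 * (t.2 j : ℤ), Function.update t.2 j (t.2 j - 1))
      let mul : List (ℤ × (Fin n → ℕ)) → List (ℤ × (Fin n → ℕ)) → List (ℤ × (Fin n → ℕ)) := fun L₁ L₂ =>
        L₁.flatMap fun s => L₂.map fun t => (s.1 * t.1, s.2 + t.2)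
      let neg : List (ℤ × (Fin n → ℕ)) → List (ℤ × (Fin n → ℕ)) := fun L => L.map fun t => (-t.1, t.2)
      let DET : Fin t → List (ℤ × (Fin n → ℕ)) := fun μ =>
        mul (pd (cols μ 0) (GS 0)) (pd (cols μ 1) (GS 1)) ++ neg (mul (pd (cols μ 0) (GS 1)) (pd (cols μ 1) (GS 0)))
      let RHS : List (ℤ × (Fin n → ℕ)) :=
        (List.finRange 2).flatMap (fun l => mul (A l) (GS l)) ++ (List.finRange t).flatMap (fun μ => mul (B μ) (DET μ))
      ∀ v ∈ e :: RHS.map (fun t => t.2),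
        (p : ℤ) ∣ (([((1 : ℤ), e)].filter fun t : ℤ × (Fin n → ℕ) => t.2 = v).map (fun t => t.1)).sum -
          ((RHS.filter fun t : ℤ × (Fin n → ℕ) => t.2 = v).map (fun t => t.1)).sum) :
    ∃ (t' : ℕ) (js : Fin t' → Fin 2 → Fin n) (e' : Fin n →₀ ℕ), (∀ i ∈ S, e' i = 0) ∧
      (monomial e' (1 : K) : MvPolynomial (Fin n) K) ∈
        Ideal.span (Set.range fun l : Fin 2 =>
            aeval (fun i : Fin n => if i ∈ S then (0 : MvPolynomial (Fin n) K) else X i)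
              ((G l).map fun t : ℤ × (Fin n → ℕ) =>
                (monomial (Finsupp.equivFunOnFinite.symm t.2) ((t.1 : ℤ) : K) : MvPolynomial (Fin n) K)).sum) ⊔
          Ideal.span (Set.range fun μ : Fin t' => (Matrix.of fun i l => pderiv (js μ i)
            (aeval (fun i : Fin n => if i ∈ S then (0 : MvPolynomial (Fin n) K) else X i)
              ((G l).map fun t : ℤ × (Fin n → ℕ) =>
                (monomial (Finsupp.equivFunOnFinite.symm t.2) ((t.1 : ℤ) : K) : MvPolynomial (Fin n) K)).sum)).det) :=
  ⟨t, cols, Finsupp.equivFunOnFinite.symm e,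
    fun i hi => by rw [Finsupp.coe_equivFunOnFinite_symm]; exact he i hi,
    hcert_two_of_lists p G S e t cols A B hcheck⟩

end Summit.ResolutionOfSingularities.ResolutionOfSingularities.Theorems.FInjectiveMacaulayfication.CIPolyKitCert

end
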